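import Literature.Barriers.CriticalPhenomena.ScaleCovarianceNotMoebius
import Literature.MathematicalPhysics.QuantumFieldTheory.PointwiseOSReconstruction

/-!
# `InversionUpgradeNormalised` (item stmt-CriticalPhenomena-1982): reflection MONOTONICITY is inside the blocked class

Negative knowledge about the crux
`Summit.CriticalPhenomena.Ising3DConformalLimit.Theses.HyperoctahedralRP.InversionUpgradeNormalised`
(standing crux disprover, cycle 2, D-0016). Two crux cards (`inversion-defect-involution`, input #1;
`circumsphere-robin-law`, the "MMS sign") propose to feed the one-sided inversion inequality / the
Robin slope of the critical limit with the Messager–Miracle-Solé / Hegerfeldt / Schrader REFLECTION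
MONOTONICITY of spin products, `⟨σ_A σ_B⟩ ≥ ⟨σ_A σ_{θB}⟩` for `A, B` on one side of a lattice mirror
`θ`, passed to the limit in every plane. This file proves that such monotonicity cannot carry the
conformal weight: the barrier witness `ScaleNotMoebius.narrowFamily Δ` of
`Literature.Barriers.CriticalPhenomena.ScaleCovarianceNotMoebiusNarrow` — which has all thirteen
model-blind surrogates of the Ising structure and is NOT inversion covariant — is reflection
monotone in every coordinate mirror, for all orders and all splits, whenever `Δ ≥ 1/2` (the Ising
window is `Δ ∈ [1/2, 1]`). Mechanism: reflecting part of a half-space configuration fixes the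
distances inside each part and increases the cross distances (`norm_sub_le_norm_sub_axisReflection`),
and `S₄ = Wick − (Σᵢⱼ‖xᵢ−xⱼ‖²)^{-2Δ}` is antitone in each of the six distances separately for
`2Δ ≥ 1` (`fourPointExpr_mono`, from the one-variable bound `core_deriv_bound` and the mean value theorem).

Consequence for provers (`not_inversionUpgrade_of_reflectionMonotone`,
`not_cruxWithReflectionMonotone`): the inequality of a `OneSidedInversion`/Robin line must be fed
by inputs `narrowFamily` violates — OS positivity of ALL orders (it is not reflection positive:
`S₆ ≡ 0 ≢ S₄`), the random-current representation of `U₄`, or lattice identities.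
-/

noncomputable section

namespace Summit.CriticalPhenomena.Ising3DConformalLimit.InversionUpgradeNormalisedNegative

open Literature.Probability.LatticeModels Literature.Barriers.CriticalPhenomena
open Literature.MathematicalPhysics.QuantumFieldTheory
open Set Function ScaleNotMoebius

/-- Pointwise derivative bound behind the reflection monotonicity of `narrowFamily`:
for `α ≥ 1`, `0 < w`, `0 < u`, `2w² ≤ K`: `4u (2u² + K)^{-(α+1)} ≤ w^{-α} u^{-(α+1)}`
(via `M = max u w`: `4 u^{α+2} w^α ≤ 4 M^{2α+2} ≤ (2M²)^{α+1} ≤ (2u² + K)^{α+1}`). [folklore] -/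
theorem core_deriv_bound {α w u K : ℝ} (hα : 1 ≤ α) (hw : 0 < w) (hu : 0 < u) (hK : 2 * w ^ 2 ≤ K) :
    4 * u * (2 * u ^ 2 + K) ^ (-(α + 1)) ≤ w ^ (-α) * u ^ (-(α + 1)) := by
  have hX : 0 < 2 * u ^ 2 + K := by nlinarith
  -- reduce to `4 u^{α+2} w^α ≤ (2u²+K)^{α+1}`
  rw [Real.rpow_neg hX.le, Real.rpow_neg hw.le, Real.rpow_neg hu.le]
  rw [show 4 * u * ((2 * u ^ 2 + K) ^ (α + 1))⁻¹ = (4 * u) / (2 * u ^ 2 + K) ^ (α + 1) by ring,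
    show (w ^ α)⁻¹ * (u ^ (α + 1))⁻¹ = 1 / (w ^ α * u ^ (α + 1)) by ring]
  rw [div_le_div_iff₀ (by positivity) (by positivity), one_mul]
  -- M := max u w
  set M := max u w with hM
  have hM0 : 0 < M := lt_max_of_lt_left hu
  have huM : u ≤ M := le_max_left _ _
  have hwM : w ≤ M := le_max_right _ _
  have h1 : 4 * u * (w ^ α * u ^ (α + 1)) ≤ 4 * M ^ (2 * α + 2) := by
    have e1 : u ^ (α + 1) ≤ M ^ (α + 1) := Real.rpow_le_rpow hu.le huM (by linarith)
    have e2 : w ^ α ≤ M ^ α := Real.rpow_le_rpow hw.le hwM (by linarith)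
    have e3 : M ^ (2 * α + 2) = M * (M ^ α * M ^ (α + 1)) := by
      rw [← Real.rpow_add hM0, show 2 * α + 2 = 1 + (α + (α + 1)) by ring, Real.rpow_add hM0,
        Real.rpow_one]
    rw [e3]
    have : w ^ α * u ^ (α + 1) ≤ M ^ α * M ^ (α + 1) :=
      mul_le_mul e2 e1 (by positivity) (by positivity)
    nlinarith [this, mul_nonneg (by positivity : (0:ℝ) ≤ M ^ α) (by positivity : (0:ℝ) ≤ M ^ (α + 1))]
  have h2 : 4 * M ^ (2 * α + 2) ≤ (2 * M ^ 2) ^ (α + 1) := by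
    rw [Real.mul_rpow (by norm_num) (by positivity), ← Real.rpow_natCast M 2, ← Real.rpow_mul hM0.le]
    push_cast
    rw [show (2 : ℝ) * (α + 1) = 2 * α + 2 by ring]
    have h4 : (4 : ℝ) ≤ 2 ^ (α + 1) := by
      calc (4 : ℝ) = 2 ^ ((2 : ℕ) : ℝ) := by rw [Real.rpow_natCast]; norm_num
        _ ≤ 2 ^ (α + 1) := Real.rpow_le_rpow_of_exponent_le (by norm_num) (by push_cast; linarith)
    exact mul_le_mul_of_nonneg_right h4 (by positivity)
  have h3 : (2 * M ^ 2) ^ (α + 1) ≤ (2 * u ^ 2 + K) ^ (α + 1) := by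
    refine Real.rpow_le_rpow (by positivity) ?_ (by linarith)
    have : M ^ 2 ≤ u ^ 2 + w ^ 2 := by
      rcases le_total u w with h | h
      · rw [hM, max_eq_right h]; nlinarith
      · rw [hM, max_eq_left h]; nlinarith
    nlinarith
  linarith

/-- The one-variable function `g(v) = w^{-α} v^{-α} - (2v² + K)^{-α}` is antitone on `(0,∞)`
for `α ≥ 1`, `2w² ≤ K` (mean value theorem, `core_deriv_bound`). [folklore] -/
theorem core_antitoneOn {α w K : ℝ} (hα : 1 ≤ α) (hw : 0 < w) (hK : 2 * w ^ 2 ≤ K) :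
    AntitoneOn (fun v : ℝ => w ^ (-α) * v ^ (-α) - (2 * v ^ 2 + K) ^ (-α)) (Ioi 0) := by
  have hKpos : 0 < K := by nlinarith
  refine antitoneOn_of_hasDerivWithinAt_nonpos (convex_Ioi 0)
    (f' := fun v => w ^ (-α) * ((-α) * v ^ (-α - 1)) - (4 * v) * (-α) * (2 * v ^ 2 + K) ^ (-α - 1)) ?_ ?_ ?_
  · -- continuity on Ioi 0
    intro v hv
    have hv' : (0:ℝ) < v := hv
    refine ContinuousAt.continuousWithinAt ?_
    have hX : 2 * v ^ 2 + K ≠ 0 := by nlinarith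
    refine ((continuousAt_const.mul (Real.continuousAt_rpow_const _ _ (Or.inl hv'.ne'))).sub ?_)
    exact (Real.continuousAt_rpow_const _ _ (Or.inl hX)).comp
      (f := fun v : ℝ => 2 * v ^ 2 + K) (by fun_prop)
  · intro v hv
    rw [interior_Ioi] at hv
    have hv' : (0:ℝ) < v := hv
    have hX : 2 * v ^ 2 + K ≠ 0 := by nlinarith
    have h1 : HasDerivAt (fun v : ℝ => v ^ (-α)) ((-α) * v ^ (-α - 1)) v :=
      Real.hasDerivAt_rpow_const (Or.inl hv'.ne')
    have h2 : HasDerivAt (fun v : ℝ => 2 * v ^ 2 + K) (4 * v) v := by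
      have := ((hasDerivAt_pow 2 v).const_mul 2).add_const K
      refine this.congr_deriv ?_
      push_cast
      ring
    have h3 : HasDerivAt (fun v : ℝ => (2 * v ^ 2 + K) ^ (-α)) ((4 * v) * (-α) * (2 * v ^ 2 + K) ^ (-α - 1)) v :=
      h2.rpow_const (Or.inl hX)
    exact ((h1.const_mul _).sub h3).hasDerivWithinAt
  · intro v hv
    rw [interior_Ioi] at hv
    have hv' : (0:ℝ) < v := hv
    have hb := core_deriv_bound hα hw hv' hK
    have hα0 : 0 < α := by linarith
    rw [show -α - 1 = -(α + 1) by ring]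
    nlinarith [hb, hα0]

/-- Two-point consequence used coordinatewise: for `0 < u ≤ u'`,
`w^{-α} u'^{-α} - (2u'² + K)^{-α} ≤ w^{-α} u^{-α} - (2u² + K)^{-α}`. [folklore] -/
theorem core_step {α w u u' K : ℝ} (hα : 1 ≤ α) (hw : 0 < w) (hu : 0 < u) (huu' : u ≤ u') (hK : 2 * w ^ 2 ≤ K) :
    w ^ (-α) * u' ^ (-α) - (2 * u' ^ 2 + K) ^ (-α) ≤ w ^ (-α) * u ^ (-α) - (2 * u ^ 2 + K) ^ (-α) :=
  core_antitoneOn hα hw hK hu (lt_of_lt_of_le hu huu') huu'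

/-- `sqSum` over ordered pairs is twice the sum over the six unordered pairs. [folklore] -/
theorem sqSum_eq (x : Fin 4 → EuclideanSpace ℝ (Fin 3)) :
    sqSum x = 2 * (‖x 0 - x 1‖ ^ 2 + ‖x 0 - x 2‖ ^ 2 + ‖x 0 - x 3‖ ^ 2 + ‖x 1 - x 2‖ ^ 2 +
      ‖x 1 - x 3‖ ^ 2 + ‖x 2 - x 3‖ ^ 2) := by
  simp only [sqSum, Fin.sum_univ_four, sub_self, norm_zero]
  rw [norm_sub_rev (x 1) (x 0), norm_sub_rev (x 2) (x 0), norm_sub_rev (x 3) (x 0),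
    norm_sub_rev (x 2) (x 1), norm_sub_rev (x 3) (x 1), norm_sub_rev (x 3) (x 2)]
  ring

/-- `narrowFamily Δ 4` as an explicit function of the six distances, on non-coincident configurations. [folklore] -/
theorem narrowFamily_four_eq (Δ : ℝ) {x : Fin 4 → EuclideanSpace ℝ (Fin 3)} (hx : Injective x) :
    narrowFamily Δ 4 x =
      (‖x 0 - x 1‖ ^ (-(2 * Δ)) * ‖x 2 - x 3‖ ^ (-(2 * Δ)) + ‖x 0 - x 2‖ ^ (-(2 * Δ)) * ‖x 1 - x 3‖ ^ (-(2 * Δ)) + ‖x 0 - x 3‖ ^ (-(2 * Δ)) * ‖x 1 - x 2‖ ^ (-(2 * Δ))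
          - (2 * (‖x 0 - x 1‖ ^ 2 + ‖x 0 - x 2‖ ^ 2 + ‖x 0 - x 3‖ ^ 2 + ‖x 1 - x 2‖ ^ 2 + ‖x 1 - x 3‖ ^ 2 + ‖x 2 - x 3‖ ^ 2)) ^ (-(2 * Δ))) := by
  rw [narrowFamily_four_of_injective Δ hx, wick, bump, sqSum_eq]
  simp only [twoPt]

/-- **Coordinatewise antitonicity of the four-point expression for `α ≥ 1`**: increasing the six
distances (weakly, independently) can only decrease
`Σ_pairings d_p^{-α} d_p̄^{-α} − (2 Σ_pairs d²)^{-α}`. Six applications of `core_step`, one per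
distance, the complementary distance playing the role of `w`. [folklore] -/
theorem fourPointExpr_mono {α : ℝ} (hα : 1 ≤ α) {a1 a2 a3 a4 a5 a6 b1 b2 b3 b4 b5 b6 : ℝ}
    (h1 : 0 < a1) (h2 : 0 < a2) (h3 : 0 < a3) (h4 : 0 < a4) (h5 : 0 < a5) (h6 : 0 < a6)
    (l1 : a1 ≤ b1) (l2 : a2 ≤ b2) (l3 : a3 ≤ b3) (l4 : a4 ≤ b4) (l5 : a5 ≤ b5) (l6 : a6 ≤ b6) :
    (b1 ^ (-α) * b6 ^ (-α) + b2 ^ (-α) * b5 ^ (-α) + b3 ^ (-α) * b4 ^ (-α)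
        - (2 * (b1 ^ 2 + b2 ^ 2 + b3 ^ 2 + b4 ^ 2 + b5 ^ 2 + b6 ^ 2)) ^ (-α))
      ≤ (a1 ^ (-α) * a6 ^ (-α) + a2 ^ (-α) * a5 ^ (-α) + a3 ^ (-α) * a4 ^ (-α)
        - (2 * (a1 ^ 2 + a2 ^ 2 + a3 ^ 2 + a4 ^ 2 + a5 ^ 2 + a6 ^ 2)) ^ (-α)) := by
  have hb1 : 0 < b1 := lt_of_lt_of_le h1 l1
  have hb2 : 0 < b2 := lt_of_lt_of_le h2 l2
  have hb3 : 0 < b3 := lt_of_lt_of_le h3 l3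
  have hb4 : 0 < b4 := lt_of_lt_of_le h4 l4
  have hb5 : 0 < b5 := lt_of_lt_of_le h5 l5
  -- step 1: coordinate 1 (pair 01, complement 23 = coordinate 6)
  have s1 :
      (b1 ^ (-α) * a6 ^ (-α) + a2 ^ (-α) * a5 ^ (-α) + a3 ^ (-α) * a4 ^ (-α)
        - (2 * (b1 ^ 2 + a2 ^ 2 + a3 ^ 2 + a4 ^ 2 + a5 ^ 2 + a6 ^ 2)) ^ (-α))
      ≤ (a1 ^ (-α) * a6 ^ (-α) + a2 ^ (-α) * a5 ^ (-α) + a3 ^ (-α) * a4 ^ (-α)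
        - (2 * (a1 ^ 2 + a2 ^ 2 + a3 ^ 2 + a4 ^ 2 + a5 ^ 2 + a6 ^ 2)) ^ (-α)) := by
    have c := core_step (K := 2 * (a2 ^ 2 + a3 ^ 2 + a4 ^ 2 + a5 ^ 2 + a6 ^ 2)) hα h6 h1 l1 (by linarith [sq_nonneg a2, sq_nonneg a3, sq_nonneg a4, sq_nonneg a5])
    rw [show 2 * (b1 ^ 2 + a2 ^ 2 + a3 ^ 2 + a4 ^ 2 + a5 ^ 2 + a6 ^ 2)
        = 2 * b1 ^ 2 + 2 * (a2 ^ 2 + a3 ^ 2 + a4 ^ 2 + a5 ^ 2 + a6 ^ 2) by ring,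
      show 2 * (a1 ^ 2 + a2 ^ 2 + a3 ^ 2 + a4 ^ 2 + a5 ^ 2 + a6 ^ 2)
        = 2 * a1 ^ 2 + 2 * (a2 ^ 2 + a3 ^ 2 + a4 ^ 2 + a5 ^ 2 + a6 ^ 2) by ring]
    linarith [c]
  -- step 2: coordinate 2 (pair 02, complement 13 = coordinate 5)
  have s2 :
      (b1 ^ (-α) * a6 ^ (-α) + b2 ^ (-α) * a5 ^ (-α) + a3 ^ (-α) * a4 ^ (-α)
        - (2 * (b1 ^ 2 + b2 ^ 2 + a3 ^ 2 + a4 ^ 2 + a5 ^ 2 + a6 ^ 2)) ^ (-α))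
      ≤ (b1 ^ (-α) * a6 ^ (-α) + a2 ^ (-α) * a5 ^ (-α) + a3 ^ (-α) * a4 ^ (-α)
        - (2 * (b1 ^ 2 + a2 ^ 2 + a3 ^ 2 + a4 ^ 2 + a5 ^ 2 + a6 ^ 2)) ^ (-α)) := by
    have c := core_step (K := 2 * (b1 ^ 2 + a3 ^ 2 + a4 ^ 2 + a5 ^ 2 + a6 ^ 2)) hα h5 h2 l2 (by linarith [sq_nonneg b1, sq_nonneg a3, sq_nonneg a4, sq_nonneg a6])
    rw [show 2 * (b1 ^ 2 + b2 ^ 2 + a3 ^ 2 + a4 ^ 2 + a5 ^ 2 + a6 ^ 2)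
        = 2 * b2 ^ 2 + 2 * (b1 ^ 2 + a3 ^ 2 + a4 ^ 2 + a5 ^ 2 + a6 ^ 2) by ring,
      show 2 * (b1 ^ 2 + a2 ^ 2 + a3 ^ 2 + a4 ^ 2 + a5 ^ 2 + a6 ^ 2)
        = 2 * a2 ^ 2 + 2 * (b1 ^ 2 + a3 ^ 2 + a4 ^ 2 + a5 ^ 2 + a6 ^ 2) by ring]
    linarith [c]
  -- step 3: coordinate 3 (pair 03, complement 12 = coordinate 4)
  have s3 :
      (b1 ^ (-α) * a6 ^ (-α) + b2 ^ (-α) * a5 ^ (-α) + b3 ^ (-α) * a4 ^ (-α)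
        - (2 * (b1 ^ 2 + b2 ^ 2 + b3 ^ 2 + a4 ^ 2 + a5 ^ 2 + a6 ^ 2)) ^ (-α))
      ≤ (b1 ^ (-α) * a6 ^ (-α) + b2 ^ (-α) * a5 ^ (-α) + a3 ^ (-α) * a4 ^ (-α)
        - (2 * (b1 ^ 2 + b2 ^ 2 + a3 ^ 2 + a4 ^ 2 + a5 ^ 2 + a6 ^ 2)) ^ (-α)) := by
    have c := core_step (K := 2 * (b1 ^ 2 + b2 ^ 2 + a4 ^ 2 + a5 ^ 2 + a6 ^ 2)) hα h4 h3 l3 (by linarith [sq_nonneg b1, sq_nonneg b2, sq_nonneg a5, sq_nonneg a6])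
    rw [show 2 * (b1 ^ 2 + b2 ^ 2 + b3 ^ 2 + a4 ^ 2 + a5 ^ 2 + a6 ^ 2)
        = 2 * b3 ^ 2 + 2 * (b1 ^ 2 + b2 ^ 2 + a4 ^ 2 + a5 ^ 2 + a6 ^ 2) by ring,
      show 2 * (b1 ^ 2 + b2 ^ 2 + a3 ^ 2 + a4 ^ 2 + a5 ^ 2 + a6 ^ 2)
        = 2 * a3 ^ 2 + 2 * (b1 ^ 2 + b2 ^ 2 + a4 ^ 2 + a5 ^ 2 + a6 ^ 2) by ring]
    linarith [c]
  -- step 4: coordinate 4 (pair 12, complement 03 = coordinate 3, now b3)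
  have s4 :
      (b1 ^ (-α) * a6 ^ (-α) + b2 ^ (-α) * a5 ^ (-α) + b3 ^ (-α) * b4 ^ (-α)
        - (2 * (b1 ^ 2 + b2 ^ 2 + b3 ^ 2 + b4 ^ 2 + a5 ^ 2 + a6 ^ 2)) ^ (-α))
      ≤ (b1 ^ (-α) * a6 ^ (-α) + b2 ^ (-α) * a5 ^ (-α) + b3 ^ (-α) * a4 ^ (-α)
        - (2 * (b1 ^ 2 + b2 ^ 2 + b3 ^ 2 + a4 ^ 2 + a5 ^ 2 + a6 ^ 2)) ^ (-α)) := by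
    have c := core_step (K := 2 * (b1 ^ 2 + b2 ^ 2 + b3 ^ 2 + a5 ^ 2 + a6 ^ 2)) hα hb3 h4 l4 (by linarith [sq_nonneg b1, sq_nonneg b2, sq_nonneg a5, sq_nonneg a6])
    rw [show 2 * (b1 ^ 2 + b2 ^ 2 + b3 ^ 2 + b4 ^ 2 + a5 ^ 2 + a6 ^ 2)
        = 2 * b4 ^ 2 + 2 * (b1 ^ 2 + b2 ^ 2 + b3 ^ 2 + a5 ^ 2 + a6 ^ 2) by ring,
      show 2 * (b1 ^ 2 + b2 ^ 2 + b3 ^ 2 + a4 ^ 2 + a5 ^ 2 + a6 ^ 2)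
        = 2 * a4 ^ 2 + 2 * (b1 ^ 2 + b2 ^ 2 + b3 ^ 2 + a5 ^ 2 + a6 ^ 2) by ring]
    linarith [c]
  -- step 5: coordinate 5 (pair 13, complement 02 = coordinate 2, now b2)
  have s5 :
      (b1 ^ (-α) * a6 ^ (-α) + b2 ^ (-α) * b5 ^ (-α) + b3 ^ (-α) * b4 ^ (-α)
        - (2 * (b1 ^ 2 + b2 ^ 2 + b3 ^ 2 + b4 ^ 2 + b5 ^ 2 + a6 ^ 2)) ^ (-α))
      ≤ (b1 ^ (-α) * a6 ^ (-α) + b2 ^ (-α) * a5 ^ (-α) + b3 ^ (-α) * b4 ^ (-α)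
        - (2 * (b1 ^ 2 + b2 ^ 2 + b3 ^ 2 + b4 ^ 2 + a5 ^ 2 + a6 ^ 2)) ^ (-α)) := by
    have c := core_step (K := 2 * (b1 ^ 2 + b2 ^ 2 + b3 ^ 2 + b4 ^ 2 + a6 ^ 2)) hα hb2 h5 l5 (by linarith [sq_nonneg b1, sq_nonneg b3, sq_nonneg b4, sq_nonneg a6])
    rw [show 2 * (b1 ^ 2 + b2 ^ 2 + b3 ^ 2 + b4 ^ 2 + b5 ^ 2 + a6 ^ 2)
        = 2 * b5 ^ 2 + 2 * (b1 ^ 2 + b2 ^ 2 + b3 ^ 2 + b4 ^ 2 + a6 ^ 2) by ring,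
      show 2 * (b1 ^ 2 + b2 ^ 2 + b3 ^ 2 + b4 ^ 2 + a5 ^ 2 + a6 ^ 2)
        = 2 * a5 ^ 2 + 2 * (b1 ^ 2 + b2 ^ 2 + b3 ^ 2 + b4 ^ 2 + a6 ^ 2) by ring]
    linarith [c]
  -- step 6: coordinate 6 (pair 23, complement 01 = coordinate 1, now b1)
  have s6 :
      (b1 ^ (-α) * b6 ^ (-α) + b2 ^ (-α) * b5 ^ (-α) + b3 ^ (-α) * b4 ^ (-α)
        - (2 * (b1 ^ 2 + b2 ^ 2 + b3 ^ 2 + b4 ^ 2 + b5 ^ 2 + b6 ^ 2)) ^ (-α))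
      ≤ (b1 ^ (-α) * a6 ^ (-α) + b2 ^ (-α) * b5 ^ (-α) + b3 ^ (-α) * b4 ^ (-α)
        - (2 * (b1 ^ 2 + b2 ^ 2 + b3 ^ 2 + b4 ^ 2 + b5 ^ 2 + a6 ^ 2)) ^ (-α)) := by
    have c := core_step (K := 2 * (b1 ^ 2 + b2 ^ 2 + b3 ^ 2 + b4 ^ 2 + b5 ^ 2)) hα hb1 h6 l6 (by linarith [sq_nonneg b2, sq_nonneg b3, sq_nonneg b4, sq_nonneg b5])
    rw [show 2 * (b1 ^ 2 + b2 ^ 2 + b3 ^ 2 + b4 ^ 2 + b5 ^ 2 + b6 ^ 2)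
        = 2 * b6 ^ 2 + 2 * (b1 ^ 2 + b2 ^ 2 + b3 ^ 2 + b4 ^ 2 + b5 ^ 2) by ring,
      show 2 * (b1 ^ 2 + b2 ^ 2 + b3 ^ 2 + b4 ^ 2 + b5 ^ 2 + a6 ^ 2)
        = 2 * a6 ^ 2 + 2 * (b1 ^ 2 + b2 ^ 2 + b3 ^ 2 + b4 ^ 2 + b5 ^ 2) by ring]
    linarith [c]
  exact s6.trans (s5.trans (s4.trans (s3.trans (s2.trans s1))))

/-- **Distance domination** (`Δ ≥ 1/2`): if every mutual distance of `y` is at least the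
corresponding one of an injective `x`, then `narrowFamily Δ n y ≤ narrowFamily Δ n x`. [folklore] -/
theorem narrowFamily_le_of_dist_le {Δ : ℝ} (hΔ : 1 / 2 ≤ Δ) {n : ℕ}
    {x y : Fin n → EuclideanSpace ℝ (Fin 3)} (hx : Injective x)
    (h : ∀ i j, ‖x i - x j‖ ≤ ‖y i - y j‖) : narrowFamily Δ n y ≤ narrowFamily Δ n x := by
  -- `y` is injective too, and the distances of `x` are positive off the diagonal
  have hy : Injective y := by
    intro i j hij
    by_contra hne
    have h1 : 0 < ‖x i - x j‖ := norm_pos_iff.2 (sub_ne_zero.2 (hx.ne hne))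
    have h2 : ‖y i - y j‖ = 0 := by rw [hij, sub_self, norm_zero]
    linarith [h i j]
  have hd : ∀ i j : Fin n, i ≠ j → 0 < ‖x i - x j‖ := fun i j hij =>
    norm_pos_iff.2 (sub_ne_zero.2 (hx.ne hij))
  clear hx
  match n, x, y, hy, h, hd with
  | 0, _, _, _, _, _ => simp [narrowFamily_zero]
  | 1, _, _, _, _, _ => exact le_refl _
  | 2, x, y, _, h, hd =>
    rw [narrowFamily_two, narrowFamily_two, twoPt, twoPt]
    exact Real.rpow_le_rpow_of_nonpos (hd 0 1 (by decide)) (h 0 1) (by linarith)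
  | 3, _, _, _, _, _ => exact le_refl _
  | 4, x, y, hy, h, hd =>
    have hx : Injective x := by
      intro i j hij
      by_contra hne
      have := hd i j hne
      rw [hij, sub_self, norm_zero] at this
      exact lt_irrefl _ this
    rw [narrowFamily_four_eq Δ hx, narrowFamily_four_eq Δ hy]
    exact fourPointExpr_mono (by linarith) (hd 0 1 (by decide)) (hd 0 2 (by decide)) (hd 0 3 (by decide))
      (hd 1 2 (by decide)) (hd 1 3 (by decide)) (hd 2 3 (by decide))
      (h 0 1) (h 0 2) (h 0 3) (h 1 2) (h 1 3) (h 2 3)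
  | (n + 5), _, _, _, _, _ => exact le_refl _

/-- Reflecting one of two points of the open half-space `{x_τ > 0}` in the mirror `{x_τ = 0}`
does not decrease their distance: `‖a - b‖ ≤ ‖a - θ_τ b‖`. [folklore] -/
theorem norm_sub_le_norm_sub_axisReflection {τ : Fin 3} {a b : EuclideanSpace ℝ (Fin 3)}
    (ha : 0 < a τ) (hb : 0 < b τ) : ‖a - b‖ ≤ ‖a - axisReflection τ b‖ := by
  rw [EuclideanSpace.norm_eq, EuclideanSpace.norm_eq]
  refine Real.sqrt_le_sqrt (Finset.sum_le_sum fun i _ => ?_)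
  simp only [PiLp.sub_apply, axisReflection_apply, Real.norm_eq_abs, sq_abs]
  split_ifs with hi
  · subst hi; nlinarith
  · exact le_refl _

/-- **The barrier witness is reflection MONOTONE in every coordinate mirror** (`Δ ≥ 1/2`, all
orders, all splits) — the Messager–Miracle-Solé 1977 / Hegerfeldt 1977 / Schrader 1977 shape
`S(a ⊔ θ_τ b) ≤ S(a ⊔ b)` for configurations `a`, `b` of the open half-space `{x_τ > 0}` with
`a ⊔ b` non-coincident: reflecting `b` fixes the distances inside each part and increases the cross
distances, and `narrowFamily Δ` is antitone in the distances. [folklore] -/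
theorem narrowFamily_reflectionMonotone {Δ : ℝ} (hΔ : 1 / 2 ≤ Δ) (τ : Fin 3) :
    ∀ (m k : ℕ) (a : Fin m → EuclideanSpace ℝ (Fin 3)) (b : Fin k → EuclideanSpace ℝ (Fin 3)),
      (∀ i, 0 < a i τ) → (∀ j, 0 < b j τ) → Function.Injective (Fin.append a b) →
      narrowFamily Δ (m + k) (Fin.append a (fun j => axisReflection τ (b j))) ≤ narrowFamily Δ (m + k) (Fin.append a b) := by
  intro m k a b ha hb hinj
  refine narrowFamily_le_of_dist_le hΔ hinj fun i j => ?_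
  refine Fin.addCases (fun i' => ?_) (fun i' => ?_) i <;> refine Fin.addCases (fun j' => ?_) (fun j' => ?_) j
  · simp only [Fin.append_left]; exact le_refl _
  · simp only [Fin.append_left, Fin.append_right]
    exact norm_sub_le_norm_sub_axisReflection (ha i') (hb j')
  · simp only [Fin.append_left, Fin.append_right]
    rw [norm_sub_rev, norm_sub_rev (axisReflection τ (b i')) (a j')]
    exact norm_sub_le_norm_sub_axisReflection (ha j') (hb i')
  · simp only [Fin.append_right, ← map_sub, LinearIsometryEquiv.norm_map]
    exact le_refl _


/-- **No inversion upgrade from reflection monotonicity** (model-blind, every `Δ ≥ 1/2`, hence on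
the whole Ising window `[1/2, 1]`): properties (1)–(13) of
`Literature.Barriers.CriticalPhenomena.ScaleCovarianceNotMoebiusNarrow` TOGETHER WITH reflection
monotonicity of all orders in the three coordinate mirrors (hence, by `O(3)` invariance (2), in
every mirror of `ℝ³`) do not imply `IsInversionCovariant Δ`. Witness: `narrowFamily Δ`.
[folklore] -/
theorem not_inversionUpgrade_of_reflectionMonotone {Δ : ℝ} (hΔ : 1 / 2 ≤ Δ) :
    ¬ ∀ S : CorrFamily 3, IsNondegenerateTwoPoint S → IsEuclideanInvariant S →
      IsScaleCovariant Δ S → HasNontrivialU4 S → (∀ n x, 0 ≤ S n x) →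
      (∀ n, Odd n → ∀ x, S n x = 0) → (∀ x, S 0 x = 1) →
      (∀ n (σ : Equiv.Perm (Fin n)) x, S n (x ∘ σ) = S n x) →
      (∀ n x, x ∉ NonCoincident 3 n → S n x = 0) →
      (∀ x ∈ NonCoincident 3 4,
        S 2 ![x 0, x 1] * S 2 ![x 2, x 3] ≤ S 4 x ∧ S 2 ![x 0, x 2] * S 2 ![x 1, x 3] ≤ S 4 x ∧
          S 2 ![x 0, x 3] * S 2 ![x 1, x 2] ≤ S 4 x) →
      (∀ x, limitConnectedFour S x ≤ 0) →
      (∀ x ∈ NonCoincident 3 4, limitConnectedFour S x < 0) →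
      (∀ x ∈ NonCoincident 3 4, ∀ i j : Fin 4, i ≠ j →
        |limitConnectedFour S x| ≤ S 2 ![x i, x j] ^ 2) →
      (∀ τ : Fin 3, ∀ (m k : ℕ) (a : Fin m → EuclideanSpace ℝ (Fin 3)) (b : Fin k → EuclideanSpace ℝ (Fin 3)),
          (∀ i, 0 < a i τ) → (∀ j, 0 < b j τ) → Function.Injective (Fin.append a b) →
          S (m + k) (Fin.append a (fun j => axisReflection τ (b j))) ≤ S (m + k) (Fin.append a b)) →
      IsInversionCovariant Δ S := by
  intro h
  have hΔ0 : 0 < Δ := by linarith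
  exact narrowFamily_not_isInversionCovariant hΔ0 (h (narrowFamily Δ)
    (narrowFamily_isNondegenerateTwoPoint Δ) (narrowFamily_isEuclideanInvariant Δ)
    (narrowFamily_isScaleCovariant Δ) (narrowFamily_hasNontrivialU4 Δ) (narrowFamily_nonneg hΔ0.le)
    (fun _ hn x => narrowFamily_odd Δ hn x) (narrowFamily_zero Δ) (narrowFamily_perm Δ)
    (narrowFamily_eq_zero_of_not_mem hΔ0.ne') (narrowFamily_griffithsII hΔ0.le)
    (limitConnectedFour_narrowFamily_nonpos Δ) (limitConnectedFour_narrowFamily_neg Δ)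
    (fun x hx _ _ hij => abs_limitConnectedFour_narrowFamily_le hΔ0.le x hx hij)
    (fun τ => narrowFamily_reflectionMonotone hΔ τ))

/-- The crux `InversionUpgradeNormalised` with its lattice clause (H1)+(H2) traded for reflection
monotonicity in the three coordinate mirrors is FALSE for every `Δ ≥ 1/2`: "MMS in all mirrors" is
no substitute for the Ising scaling-limit hypothesis. [folklore] -/
theorem not_cruxWithReflectionMonotone {Δ : ℝ} (hΔ : 1 / 2 ≤ Δ) :
    ¬ ∀ S : CorrFamily 3, (∀ n z, z ∉ NonCoincident 3 n → S n z = 0) → IsNondegenerateTwoPoint S →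
      IsEuclideanInvariant S → IsScaleCovariant Δ S →
      (∀ τ : Fin 3, ∀ (m k : ℕ) (a : Fin m → EuclideanSpace ℝ (Fin 3)) (b : Fin k → EuclideanSpace ℝ (Fin 3)),
          (∀ i, 0 < a i τ) → (∀ j, 0 < b j τ) → Function.Injective (Fin.append a b) →
          S (m + k) (Fin.append a (fun j => axisReflection τ (b j))) ≤ S (m + k) (Fin.append a b)) →
      IsInversionCovariant Δ S := by
  intro h
  have hΔ0 : 0 < Δ := by linarith
  exact narrowFamily_not_isInversionCovariant hΔ0 (h (narrowFamily Δ)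
    (narrowFamily_eq_zero_of_not_mem hΔ0.ne') (narrowFamily_isNondegenerateTwoPoint Δ)
    (narrowFamily_isEuclideanInvariant Δ) (narrowFamily_isScaleCovariant Δ)
    (fun τ => narrowFamily_reflectionMonotone hΔ τ))

end Summit.CriticalPhenomena.Ising3DConformalLimit.InversionUpgradeNormalisedNegative

end
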